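import Summits.Parity.GeneralizedHardyLittlewood.Theorems.FordMaynardNoSieveConst0164NegWitness0164FamilyOne
import Literature.NumberTheory.Sieve.FordMaynardPolyLip

/-!
# Route `FordMaynardNoSieveConst0164`, crux `NegWitness0164` (stmt-Parity-19102), line `birth`,
# stub `stub_tweakNeg0164`: step data on boxes are admissible raw data (toward the witness (W))

Helper file toward the certificate stub (K. Ford, J. Maynard, *On the theory of prime producing sieves*,
arXiv:2407.14368, Definition 6.2 (b) and §8).  `stub_tweakNeg0164_of_shape''` (`…FamilyOne`) asks for a witness
`F₀ ∈ 𝒮`, piecewise Lipschitz in each dimension, of the Ford–Maynard / class-R shape.  Its dimension-3 and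
dimension-4 parts are FIXED for the whole class — the constant `-1` on the half-open box `[ν, 1/2)^k` — and its
dimension-5 part is a nonnegative step function on cell boxes.  Here, def-free (the functions are written as
lambdas):

* `isPolyhedral_halfOpenBox`, `isBounded_halfOpenBox` — `{x ∈ ℝ^k : lo ≤ xᵢ < hi}` is a bounded polyhedral set;
* `isPiecewiseLipschitz_const_halfOpenBox` — `x ↦ 𝟙[lo ≤ xᵢ < hi ∀ i] · c` is piecewise Lipschitz
  (Definition 6.2 (b): one convex polytope, a constant on it);
* `negBox_*_0164` — the dimension-3/4 parts `x ↦ -𝟙[41/250 ≤ xᵢ < 1/2]`: piecewise Lipschitz, values in `[-1, 0]`,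
  `= -1` at the small vectors of the support, invariant under permutations, supported on `{xᵢ ≥ 41/250}`
  (the hypotheses `h3eq`, `h3`, `h4` of `stub_tweakNeg0164_of_shape''`);
* `isPiecewiseLipschitz_sum_const_halfOpenBox` — finite sums of such box steps (the dimension-5 table) are
  piecewise Lipschitz.

References: [FordMaynard2024PrimeSieves] arXiv:2407.14368, Definition 6.2 (b), §8 (f_{3,0} = f_{4,0} = −1).
-/

noncomputable section

open Finset MeasureTheory Set
open scoped Classical
open Literature.NumberTheory.Sieve Literature.NumberTheory.Sieve.FordMaynard

namespace Summit.Parity.GeneralizedHardyLittlewood.FordMaynardNoSieveConst0164NegWitness0164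

/-- A half-open coordinate box `{x : lo ≤ xᵢ < hi}` is polyhedral. [folklore] -/
theorem isPolyhedral_halfOpenBox (k : ℕ) (lo hi : Fin k → ℝ) :
    IsPolyhedral {x : Fin k → ℝ | ∀ i, lo i ≤ x i ∧ x i < hi i} := by
  refine IsPolyhedral.setOf_forall fun i => IsPolyhedral.setOf_and ?_ ?_
  · simpa using isPolyhedral_ge (LinearMap.proj (R := ℝ) (φ := fun _ : Fin k => ℝ) i) (lo i)
  · simpa using isPolyhedral_lt (LinearMap.proj (R := ℝ) (φ := fun _ : Fin k => ℝ) i) (hi i)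

/-- A half-open coordinate box is bounded. [folklore] -/
theorem isBounded_halfOpenBox (k : ℕ) (lo hi : Fin k → ℝ) :
    Bornology.IsBounded {x : Fin k → ℝ | ∀ i, lo i ≤ x i ∧ x i < hi i} := by
  refine (isBounded_box k ((∑ i, |lo i|) + ∑ i, |hi i|)).subset fun x hx => ?_
  intro i
  have h1 := (hx i).1
  have h2 := (hx i).2
  have hlo : |lo i| ≤ ∑ j, |lo j| := Finset.single_le_sum (fun j _ => abs_nonneg (lo j)) (Finset.mem_univ i)
  have hhi : |hi i| ≤ ∑ j, |hi j| := Finset.single_le_sum (fun j _ => abs_nonneg (hi j)) (Finset.mem_univ i)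
  rw [abs_le]
  constructor
  · have := neg_abs_le (lo i)
    have : 0 ≤ ∑ j, |hi j| := Finset.sum_nonneg fun j _ => abs_nonneg _
    linarith
  · have := le_abs_self (hi i)
    have : 0 ≤ ∑ j, |lo j| := Finset.sum_nonneg fun j _ => abs_nonneg _
    linarith

/-- **A constant on a half-open box is piecewise Lipschitz** (Definition 6.2 (b) with one polytope).
[cite: FordMaynard2024PrimeSieves, Definition 6.2 (b)] -/
theorem isPiecewiseLipschitz_const_halfOpenBox (k : ℕ) (lo hi : Fin k → ℝ) (c : ℝ) :
    IsPiecewiseLipschitz (fun x : Fin k → ℝ => if ∀ i, lo i ≤ x i ∧ x i < hi i then c else 0) := by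
  refine IsPiecewiseLipschitz'.isPiecewiseLipschitz ?_
  refine ⟨Unit, inferInstance, fun _ => {x : Fin k → ℝ | ∀ i, lo i ≤ x i ∧ x i < hi i},
    fun _ x => if ∀ i, lo i ≤ x i ∧ x i < hi i then c else 0, fun _ => ⟨isPolyhedral_halfOpenBox k lo hi,
      isBounded_halfOpenBox k lo hi, fun x hx => if_neg hx, ⟨0, ?_⟩⟩, fun x => by simp⟩
  refine LipschitzOnWith.of_dist_le_mul fun x hx y hy => ?_
  have hx' : ∀ i, lo i ≤ x i ∧ x i < hi i := hx
  have hy' : ∀ i, lo i ≤ y i ∧ y i < hi i := hy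
  show dist (if ∀ i, lo i ≤ x i ∧ x i < hi i then c else 0) (if ∀ i, lo i ≤ y i ∧ y i < hi i then c else 0) ≤ _
  rw [if_pos hx', if_pos hy', dist_self]
  simp

/-- **Finite sums of box steps are piecewise Lipschitz** (the shape of a dimension-5 cell table).
[cite: FordMaynard2024PrimeSieves, Definition 6.2 (b)] -/
theorem isPiecewiseLipschitz_sum_const_halfOpenBox (k : ℕ) {κ : Type*} (s : Finset κ)
    (lo hi : κ → Fin k → ℝ) (c : κ → ℝ) :
    IsPiecewiseLipschitz (fun x : Fin k → ℝ =>
      ∑ j ∈ s, (if ∀ i, lo j i ≤ x i ∧ x i < hi j i then c j else 0)) :=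
  (IsPiecewiseLipschitz'.finset_sum s fun j _ =>
    (isPiecewiseLipschitz_const_halfOpenBox k (lo j) (hi j) (c j)).isPiecewiseLipschitz').isPiecewiseLipschitz

/-! ### The dimension-3 and dimension-4 parts of every witness: `-𝟙[41/250 ≤ xᵢ < 1/2]` -/

/-- `x ↦ -𝟙[41/250 ≤ xᵢ < 1/2 ∀ i]` is piecewise Lipschitz. [cite: FordMaynard2024PrimeSieves, §8 (f_{3,0} = f_{4,0} = −1)] -/
theorem negBox_isPiecewiseLipschitz_0164 (k : ℕ) :
    IsPiecewiseLipschitz (fun x : Fin k → ℝ =>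
      if ∀ i, (41 / 250 : ℝ) ≤ x i ∧ x i < 1 / 2 then (-1 : ℝ) else 0) :=
  isPiecewiseLipschitz_const_halfOpenBox k (fun _ => 41 / 250) (fun _ => 1 / 2) (-1)

/-- Its values lie in `[-1, 0]`. [folklore] -/
theorem negBox_mem_0164 {k : ℕ} (x : Fin k → ℝ) :
    -1 ≤ (if ∀ i, (41 / 250 : ℝ) ≤ x i ∧ x i < 1 / 2 then (-1 : ℝ) else 0) ∧
      (if ∀ i, (41 / 250 : ℝ) ≤ x i ∧ x i < 1 / 2 then (-1 : ℝ) else 0) ≤ 0 := by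
  split_ifs <;> norm_num

/-- It equals `-1` at every small vector of the support. [folklore] -/
theorem negBox_eq_neg_one_0164 {k : ℕ} (x : Fin k → ℝ) (h1 : ∀ i, (41 / 250 : ℝ) ≤ x i)
    (h2 : ∀ i, x i < 1 / 2) :
    (if ∀ i, (41 / 250 : ℝ) ≤ x i ∧ x i < 1 / 2 then (-1 : ℝ) else 0) = -1 :=
  if_pos fun i => ⟨h1 i, h2 i⟩

/-- It is invariant under permutations of the coordinates. [cite: FordMaynard2024PrimeSieves, Definition 6.1] -/
theorem negBox_comp_perm_0164 {k : ℕ} (σ : Equiv.Perm (Fin k)) (x : Fin k → ℝ) :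
    (if ∀ i, (41 / 250 : ℝ) ≤ (x ∘ σ) i ∧ (x ∘ σ) i < 1 / 2 then (-1 : ℝ) else 0) =
      (if ∀ i, (41 / 250 : ℝ) ≤ x i ∧ x i < 1 / 2 then (-1 : ℝ) else 0) := by
  have hiff : (∀ i, (41 / 250 : ℝ) ≤ (x ∘ σ) i ∧ (x ∘ σ) i < 1 / 2) ↔ ∀ i, (41 / 250 : ℝ) ≤ x i ∧ x i < 1 / 2 :=
    ⟨fun h i => by simpa using h (σ.symm i), fun h i => h (σ i)⟩
  simp only [hiff]

/-- Where it is nonzero, all coordinates are `≥ 41/250`. [folklore] -/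
theorem negBox_support_0164 {k : ℕ} (x : Fin k → ℝ)
    (h : (if ∀ i, (41 / 250 : ℝ) ≤ x i ∧ x i < 1 / 2 then (-1 : ℝ) else 0) ≠ 0) :
    ∀ i, (41 / 250 : ℝ) ≤ x i ∧ x i < 1 / 2 := by
  by_contra hc
  exact h (if_neg hc)

end Summit.Parity.GeneralizedHardyLittlewood.FordMaynardNoSieveConst0164NegWitness0164

end
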